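import Summits.QuantumFields.YangMills.Theorems.BalabanLadderUVSeamRecOddCycleChessboardPotential

/-!
# Odd-cycle chessboard WITHOUT block divisibility — part IIb: reachability of `∅` and the chessboard bound

Helper file (`--supports stmt-QuantumFields-20043`, count-neutral) of seat `ym-infvol-p3` g10, completing parts I
(`…OddCycleChessboard.lean`) and IIa (`…OddCycleChessboardPotential.lean`).  HONEST FRAMING: finite combinatorics /
reflection-positivity bookkeeping on ONE axis of an odd torus; nothing about the `d`-dimensional block version (open at
prime sides), the universal (free-energy) bound, E0′, the gap or Clay.

CONTENT.  (1) If every valid reflection of `A` is a symmetry axis then, fixing a valid `x₀` and `a₀ ∈ A`, the map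
`x ↦ a₀ + 2(x − x₀)` injects the valid reflections into `A` (`card_valid_le_of_forall_isSymm`; two axes compose to a
translation stabilising `A`, and `2` is invertible mod `2S+1`).  (2) Each slab invalidates at most `2w − 3` reflections
(`card_valid_ge`).  Hence a non-empty configuration with `(2w−2)·#A < 2S+1` has a valid reflection that is NOT a
symmetry axis (`exists_valid_not_isSymm`).  (3) At such a reflection either `A` sits in one closed half (and reaches `∅`
in one move), or the lighter symmetrisation has fewer slabs, or (balanced case) one symmetrisation has the same number of
slabs and strictly larger pair potential (part IIa) — `reaches_step`; induction on `(#A, pot)` gives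
`reaches_of_sparse`: EVERY non-empty compatible `A` with `(2w−2)·#A < 2S+1` reaches `∅`.  (4) With part I's extremal
reduction: **`le_pow_card_oddCycle`** — on `ℤ/(2S+1)`, `w ≥ 2`, for `p ≥ 0` on compatible configurations with
`p ∅ ≤ 1` and reflection Cauchy–Schwarz (closed halves) at every valid reflection, if `p D ≤ λ ^ #D` for the DENSE
compatible `D` (`(2w−2)·#D ≥ 2S+1`, i.e. more than half the layers covered) then `p A ≤ λ ^ #A` for every compatible
`A` — the Fröhlich–Israel–Lieb–Simon chessboard bound with the «all blocks of the tiling bad» calibration replaced by the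
dense configurations of the cycle, valid at EVERY odd side, prime or not.

What is NOT here: the Wilson-action realisation (the Cauchy–Schwarz inputs for slab events under the site/link reflections
of an odd torus are in `Theorems/BalabanLadderIROddTorusWeightedRP.lean`), the `d ≥ 2` block version.

References: J. Fröhlich, R. Israel, E. H. Lieb, B. Simon, Commun. Math. Phys. 62 (1978) 1–34; S. Friedli, Y. Velenik,
*Statistical Mechanics of Lattice Systems* (CUP 2017) Remark 10.4 / Thm. 10.11 (even side).
-/

set_option autoImplicit false

noncomputable section

open Finset

namespace Summit.QuantumFields.YangMills.Theorems.OddCycleChessboard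

section Reach

variable {S w : ℕ}

/-- Two symmetry axes `x₀`, `x` give the translation `a ↦ a + 2(x − x₀)` preserving `A`. -/
theorem add_mem_of_isSymm {x₀ x : ZMod (2 * S + 1)} {A : Finset (ZMod (2 * S + 1))}
    (h₀ : IsSymm w x₀ A) (h : IsSymm w x A) {a : ZMod (2 * S + 1)} (ha : a ∈ A) :
    a + 2 * (x - x₀) ∈ A := by
  have := h _ (h₀ a ha)
  have hcalc : refl w x (refl w x₀ a) = a + 2 * (x - x₀) := by unfold refl; ring
  exact hcalc ▸ this

/-- `2` is invertible in `ℤ/(2S+1)`: `2t = 0 → t = 0`. -/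
theorem eq_zero_of_two_mul_eq_zero {t : ZMod (2 * S + 1)} (h : 2 * t = 0) : t = 0 := by
  have h1 : ((S : ZMod (2 * S + 1)) + 1) * 2 = 1 := by
    have : ((2 * S + 1 : ℕ) : ZMod (2 * S + 1)) = 0 := ZMod.natCast_self _
    push_cast at this
    linear_combination this
  calc t = (((S : ZMod (2 * S + 1)) + 1) * 2) * t := by rw [h1, one_mul]
    _ = ((S : ZMod (2 * S + 1)) + 1) * (2 * t) := by ring
    _ = 0 := by rw [h, mul_zero]

/-- **If every valid reflection is a symmetry axis, there are at most `#A` valid reflections** (`A ≠ ∅`): for a set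
`V` of valid reflections, `x ↦ a₀ + 2(x − x₀)` injects `V` into `A`. -/
theorem card_valid_le_of_forall_isSymm {A : Finset (ZMod (2 * S + 1))} (hA : A.Nonempty)
    {V : Finset (ZMod (2 * S + 1))} (hV : ∀ x ∈ V, Valid w x A) (h : ∀ x, Valid w x A → IsSymm w x A) :
    #V ≤ #A := by
  classical
  obtain ⟨a₀, ha₀⟩ := hA
  by_cases hV0 : V = ∅
  · rw [hV0]; simp
  obtain ⟨x₀, hx₀⟩ := nonempty_iff_ne_empty.2 hV0
  refine card_le_card_of_injOn (fun x => a₀ + 2 * (x - x₀)) (fun x hx => ?_) (fun x _ y _ hxy => ?_)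
  · exact add_mem_of_isSymm (h x₀ (hV x₀ hx₀)) (h x (hV x hx)) ha₀
  · have h2 : 2 * (x - y) = 0 := by
      have hxy' : a₀ + 2 * (x - x₀) = a₀ + 2 * (y - x₀) := hxy
      linear_combination hxy'
    have := eq_zero_of_two_mul_eq_zero h2
    exact sub_eq_zero.1 this

/-- **Few invalid reflections**: each slab invalidates at most `2w − 3` reflections, so a set `V` containing every valid
reflection has `(2S+1) ≤ #V + (2w−3)·#A`. -/
theorem card_valid_ge (hw : 2 ≤ w) (A : Finset (ZMod (2 * S + 1))) {V : Finset (ZMod (2 * S + 1))}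
    (hV : ∀ x, Valid w x A → x ∈ V) : 2 * S + 1 ≤ #V + (2 * w - 3) * #A := by
  classical
  -- the reflections outside `V` are invalid, hence lie in the union over `a ∈ A` of the bad sets
  set bad : ZMod (2 * S + 1) → Finset (ZMod (2 * S + 1)) :=
    fun a => (univ : Finset (ZMod (2 * S + 1))).filter (fun x => ¬ (InPlus w x a ∨ InMinus w x a)) with hbad
  have hcover : (univ : Finset (ZMod (2 * S + 1))) \ V ⊆ A.biUnion bad := by
    intro x hx
    rw [mem_sdiff] at hx
    have hnv : ¬ Valid w x A := fun hval => hx.2 (hV x hval)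
    obtain ⟨a, ha, hna⟩ : ∃ a ∈ A, ¬ (InPlus w x a ∨ InMinus w x a) := by
      by_contra hc
      push Not at hc
      exact hnv (fun a ha => by have := hc a ha; tauto)
    exact mem_biUnion.2 ⟨a, ha, mem_filter.2 ⟨mem_univ _, hna⟩⟩
  have hbadcard : ∀ a, #(bad a) ≤ 2 * w - 3 := by
    intro a
    -- `bad a` injects by `x ↦ (a - x).val` into the offsets `[S+2-w, S] ∪ [2S+3-w, 2S]`
    have hinj : Set.InjOn (fun x : ZMod (2 * S + 1) => (a - x).val) (bad a : Set (ZMod (2 * S + 1))) :=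
      fun x _ y _ hxy => by simpa using (ZMod.val_injective _ hxy : a - x = a - y)
    have himg : (bad a).image (fun x => (a - x).val) ⊆
        (Finset.Icc (S + 2 - w) S ∪ Finset.Icc (2 * S + 3 - w) (2 * S)) := by
      intro u hu
      obtain ⟨y, hy, rfl⟩ := mem_image.1 hu
      have hy' := (mem_filter.1 hy).2
      unfold InPlus InMinus at hy'
      have := ZMod.val_lt (a - y)
      simp only [mem_union, mem_Icc]
      omega
    calc #(bad a) = #((bad a).image (fun x => (a - x).val)) := (card_image_of_injOn hinj).symm
      _ ≤ #(Finset.Icc (S + 2 - w) S ∪ Finset.Icc (2 * S + 3 - w) (2 * S)) := card_le_card himg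
      _ ≤ #(Finset.Icc (S + 2 - w) S) + #(Finset.Icc (2 * S + 3 - w) (2 * S)) := card_union_le _ _
      _ ≤ 2 * w - 3 := by simp only [Nat.card_Icc]; omega
  have h1 : #((univ : Finset (ZMod (2 * S + 1))) \ V) ≤ (2 * w - 3) * #A :=
    calc _ ≤ #(A.biUnion bad) := card_le_card hcover
      _ ≤ ∑ a ∈ A, #(bad a) := card_biUnion_le
      _ ≤ ∑ a ∈ A, (2 * w - 3) := sum_le_sum fun a _ => hbadcard a
      _ = (2 * w - 3) * #A := by rw [sum_const, smul_eq_mul, mul_comm]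
  have h2 : #((univ : Finset (ZMod (2 * S + 1))) \ V) = 2 * S + 1 - #V := by
    rw [card_sdiff_of_subset (subset_univ V), card_univ, ZMod.card]
  have h3 : #V ≤ 2 * S + 1 := by
    calc #V ≤ #(univ : Finset (ZMod (2 * S + 1))) := card_le_univ V
      _ = 2 * S + 1 := by rw [card_univ, ZMod.card]
  omega

/-- **A non-dense non-empty configuration has a valid reflection that is not a symmetry axis**
(`(2w−2)·#A < 2S+1`). -/
theorem exists_valid_not_isSymm (hw : 2 ≤ w) {A : Finset (ZMod (2 * S + 1))} (hA : A.Nonempty)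
    (hsparse : (2 * w - 2) * #A < 2 * S + 1) : ∃ x, Valid w x A ∧ ¬ IsSymm w x A := by
  classical
  by_contra h
  push Not at h
  set V := (univ : Finset (ZMod (2 * S + 1))).filter (fun x => Valid w x A) with hVdef
  have h1 := card_valid_le_of_forall_isSymm (w := w) hA (V := V) (fun x hx => (mem_filter.1 hx).2) h
  have h2 := card_valid_ge hw A (V := V) (fun x hx => mem_filter.2 ⟨mem_univ _, hx⟩)
  have : (2 * w - 3) * #A + #A = (2 * w - 2) * #A := by
    have h3 : 2 * w - 2 = (2 * w - 3) + 1 := by omega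
    rw [h3, Nat.add_mul, one_mul]
  omega

/-- A configuration inside one closed NEGATIVE half also reaches `∅` in one move (it is inside the closed positive half
of `x + S + 1`). -/
theorem reaches_of_forall_inMinus (w : ℕ) {x : ZMod (2 * S + 1)} {A : Finset (ZMod (2 * S + 1))}
    (h : ∀ a ∈ A, InMinus w x a) : Reaches (Valid w) (symP w) (symM w) A := by
  refine reaches_of_forall_inPlus w (x := x + (S : ZMod (2 * S + 1)) + 1) fun a ha => ?_
  have hm := h a ha
  unfold InMinus at hm; unfold InPlus
  have hlt := ZMod.val_lt (a - x)
  have hS : S + 1 < 2 * S + 1 := by omega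
  have hval : (a - (x + S + 1)).val = (a - x).val - (S + 1) := by
    have : a - (x + ↑S + 1) = (a - x) - ((S + 1 : ℕ) : ZMod (2 * S + 1)) := by push_cast; ring
    rw [this, ZMod.val_sub (by rw [ZMod.val_cast_of_lt hS]; omega), ZMod.val_cast_of_lt hS]
  omega

/-- `#(symP w x A) = 2 · #(A.filter (InPlus w x))` (`w ≥ 2`). -/
theorem card_symP_eq (hw : 2 ≤ w) (x : ZMod (2 * S + 1)) (A : Finset (ZMod (2 * S + 1))) :
    #(symP w x A) = 2 * #(A.filter (InPlus w x)) := by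
  classical
  have hdisj : Disjoint (A.filter (InPlus w x)) ((A.filter (InPlus w x)).image (refl w x)) := by
    rw [disjoint_left]; intro c hc hc'
    obtain ⟨b, hb, rfl⟩ := mem_image.1 hc'
    exact not_inPlus_of_inMinus (by omega) (inMinus_refl_of_inPlus hw (mem_filter.1 hb).2) (mem_filter.1 hc).2
  rw [symP, card_union_of_disjoint hdisj, card_image_of_injective _ (refl_injective w x)]; ring

/-- `#(symM w x A) = 2 · #(A.filter (¬ InPlus w x ·))` at a valid reflection (`w ≥ 2`). -/
theorem card_symM_eq (hw : 2 ≤ w) {x : ZMod (2 * S + 1)} {A : Finset (ZMod (2 * S + 1))} (hv : Valid w x A) :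
    #(symM w x A) = 2 * #(A.filter (fun a => ¬ InPlus w x a)) := by
  classical
  have hdisj : Disjoint (A.filter (fun a => ¬ InPlus w x a))
      ((A.filter (fun a => ¬ InPlus w x a)).image (refl w x)) := by
    rw [disjoint_left]; intro c hc hc'
    obtain ⟨b, hb, rfl⟩ := mem_image.1 hc'
    have hbm : InMinus w x b := (hv b (mem_filter.1 hb).1).resolve_left (mem_filter.1 hb).2
    exact (mem_filter.1 hc).2 (inPlus_refl_of_inMinus hw hbm)
  rw [symM, card_union_of_disjoint hdisj, card_image_of_injective _ (refl_injective w x)]; ring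

/-- **One step of the reachability induction**: a non-dense non-empty compatible configuration either sits in one closed
half (reaching `∅` at once), or has a valid non-symmetry reflection whose lighter symmetrisation has fewer slabs, or
(balanced case) one of whose symmetrisations has the same number of slabs and a strictly larger pair potential. -/
theorem reaches_step (hw : 2 ≤ w) {A : Finset (ZMod (2 * S + 1))} (hne : A.Nonempty) (hcomp : Compatible w A)
    (hsparse : (2 * w - 2) * #A < 2 * S + 1)
    (ih_small : ∀ B : Finset (ZMod (2 * S + 1)), B.Nonempty → Compatible w B → #B < #A →
      Reaches (Valid w) (symP w) (symM w) B)
    (ih_pot : ∀ B : Finset (ZMod (2 * S + 1)), B.Nonempty → Compatible w B → #B = #A → pot A < pot B →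
      Reaches (Valid w) (symP w) (symM w) B) :
    Reaches (Valid w) (symP w) (symM w) A := by
  classical
  obtain ⟨x, hv, hns⟩ := exists_valid_not_isSymm hw hne hsparse
  set P := A.filter (InPlus w x) with hP
  set R := A.filter (fun a => ¬ InPlus w x a) with hR
  have hcardA : #P + #R = #A := card_filter_add_card_filter_not (s := A) (InPlus w x)
  by_cases hR0 : R = ∅
  · -- every slab in the closed positive half
    exact reaches_of_forall_inPlus w (x := x) fun a ha => by
      by_contra hna; have : a ∈ R := mem_filter.2 ⟨ha, hna⟩; rw [hR0] at this; simp at this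
  by_cases hP0 : P = ∅
  · -- every slab in the closed negative half
    exact reaches_of_forall_inMinus w (x := x) fun a ha => (hv a ha).resolve_left fun hpa => by
      have : a ∈ P := mem_filter.2 ⟨ha, hpa⟩; rw [hP0] at this; simp at this
  have hPne : (symP w x A).Nonempty := by
    obtain ⟨a, ha⟩ := nonempty_iff_ne_empty.2 hP0
    exact ⟨a, by rw [symP]; exact mem_union_left _ ha⟩
  have hMne : (symM w x A).Nonempty := by
    obtain ⟨a, ha⟩ := nonempty_iff_ne_empty.2 hR0
    exact ⟨a, by rw [symM]; exact mem_union_left _ ha⟩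
  have hcP := card_symP_eq hw x A
  have hcM := card_symM_eq hw hv
  rw [← hP] at hcP; rw [← hR] at hcM
  rcases lt_trichotomy #R #P with hlt | heq | hgt
  · exact Reaches.minus x hv (ih_small _ hMne (compatible_symM hw hcomp hv) (by omega))
  · -- balanced: potential progress
    rcases pot_lt_of_not_isSymm hw hv hns with hp | hp
    · exact Reaches.plus x hv (ih_pot _ hPne (compatible_symP hw hcomp) (by omega) hp)
    · exact Reaches.minus x hv (ih_pot _ hMne (compatible_symM hw hcomp hv) (by omega) hp)
  · exact Reaches.plus x hv (ih_small _ hPne (compatible_symP hw hcomp) (by omega))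

/-- A crude bound for the pair potential: `pot B ≤ (2S+1)² · 2^{2S+1}`. -/
theorem pot_le (B : Finset (ZMod (2 * S + 1))) : pot B ≤ (2 * S + 1) * (2 * S + 1) * 2 ^ (2 * S + 1) := by
  classical
  have hB : #B ≤ 2 * S + 1 := by
    calc #B ≤ #(univ : Finset (ZMod (2 * S + 1))) := card_le_univ B
      _ = 2 * S + 1 := by rw [card_univ, ZMod.card]
  unfold pot
  calc ∑ a ∈ B, ∑ b ∈ B, (if a = b then 0 else 2 ^ (2 * S + 1 - (b - a).val))
      ≤ ∑ a ∈ B, ∑ b ∈ B, 2 ^ (2 * S + 1) :=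
        sum_le_sum fun a _ => sum_le_sum fun b _ => by
          split_ifs
          · exact Nat.zero_le _
          · exact Nat.pow_le_pow_right (by norm_num) (by omega)
    _ = #B * (#B * 2 ^ (2 * S + 1)) := by rw [sum_const, smul_eq_mul, sum_const, smul_eq_mul]
    _ ≤ (2 * S + 1) * ((2 * S + 1) * 2 ^ (2 * S + 1)) := Nat.mul_le_mul hB (Nat.mul_le_mul hB le_rfl)
    _ = (2 * S + 1) * (2 * S + 1) * 2 ^ (2 * S + 1) := by ring

/-- **Part II: every non-empty compatible configuration with `(2w−2)·#A < 2S+1` reaches `∅`** (`w ≥ 2`), by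
induction on the number of slabs and, for a fixed number, downward induction on the pair potential. -/
theorem reaches_of_sparse (hw : 2 ≤ w) {A : Finset (ZMod (2 * S + 1))} (hne : A.Nonempty)
    (hcomp : Compatible w A) (hsparse : (2 * w - 2) * #A < 2 * S + 1) :
    Reaches (Valid w) (symP w) (symM w) A := by
  classical
  set T : ℕ := (2 * S + 1) * (2 * S + 1) * 2 ^ (2 * S + 1) with hT
  suffices H : ∀ n k : ℕ, ∀ B : Finset (ZMod (2 * S + 1)), #B = n → T - pot B = k → B.Nonempty →
      Compatible w B → (2 * w - 2) * #B < 2 * S + 1 → Reaches (Valid w) (symP w) (symM w) B from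
    H _ _ A rfl rfl hne hcomp hsparse
  intro n
  induction n using Nat.strong_induction_on with
  | _ n ihn =>
    intro k
    induction k using Nat.strong_induction_on with
    | _ k ihk =>
      intro B hBn hBk hBne hBc hBs
      refine reaches_step hw hBne hBc hBs (fun C hCne hCc hClt => ?_) (fun C hCne hCc hCeq hpot => ?_)
      · exact ihn #C (hBn ▸ hClt) (T - pot C) C rfl rfl hCne hCc
          (lt_of_le_of_lt (Nat.mul_le_mul_left _ hClt.le) hBs)
      · have hTC := pot_le C
        exact ihk (T - pot C) (by rw [← hBk, hT]; omega) C (hCeq.trans hBn) rfl hCne hCc (by rw [hCeq]; exact hBs)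

/-- **The chessboard bound on the odd cycle `ℤ/(2S+1)` WITHOUT block divisibility** (`w ≥ 2`): if `p ≥ 0` on
compatible configurations of slabs of width `w`, `p ∅ ≤ 1`, `p` obeys reflection Cauchy–Schwarz with closed halves at
every valid reflection, and `p D ≤ λ ^ #D` (`λ > 0`) for every compatible `D` with `(2w−2)·#D ≥ 2S+1` (the DENSE
configurations: more than half of the layers covered), then `p A ≤ λ ^ #A` for EVERY compatible `A`. -/
theorem le_pow_card_oddCycle {w : ℕ} (hw : 2 ≤ w) {p : Finset (ZMod (2 * S + 1)) → ℝ} {lam : ℝ}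
    (hlam : 0 < lam) (h0 : ∀ A, Compatible w A → 0 ≤ p A) (hempty : p ∅ ≤ 1)
    (hcs : ∀ A x, Compatible w A → Valid w x A → p A ^ 2 ≤ p (symP w x A) * p (symM w x A))
    (hdense : ∀ D, Compatible w D → 2 * S + 1 ≤ (2 * w - 2) * #D → p D ≤ lam ^ #D)
    {A : Finset (ZMod (2 * S + 1))} (hA : Compatible w A) : p A ≤ lam ^ #A :=
  le_pow_card_oddCycle_of_reaches hw hlam h0 hempty hcs (Dense := fun D => 2 * S + 1 ≤ (2 * w - 2) * #D) hdense
    (fun _ hB hne hnd => reaches_of_sparse hw hne hB (lt_of_not_ge hnd)) hA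

end Reach

end Summit.QuantumFields.YangMills.Theorems.OddCycleChessboard
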